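import Mathlib
import HarnessLib
import Literature.NumberTheory.LFunctions.VanDerCorputZeta
import Literature.NumberTheory.LFunctions.ExplicitAProcess

/-!
# Weyl differencing for the Robert–Sargos fourth derivative test: the symmetric `A`-process and
# the `A × A` lemma

Topic `Literature/NumberTheory/LFunctions`. Everything in this file is PROVED (no `sorry`, no named
facts). It supplies the two differencing inequalities used in Steps 1–2 of the proof of Theorem 1
of O. Robert, P. Sargos, *A fourth derivative test for exponential sums*, Compositio Math. 130 (2002),
275–292 (= arXiv:2307.03562):

* the Weyl–van der Corput inequality "in the form that uses symmetrical differences"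
  (Huxley, *Area, Lattice Points and Exponential Sums*, Lemma 5.6.2; Robert–Sargos (4.3)):
  `‖∑_{a<n≤b} e(f(n))‖² ≤ 3L²/H + (6L/H) ∑_{d=1}^{H-1} ‖∑_{a+d<n≤b-d} e(f(n+d) - f(n-d))‖`
  (`L = b - a ≥ H ≥ 1`; `vanDerCorput_symmetric_e`), proved as the weighted inequality of
  `ExplicitAProcess.lean` but averaging over the EVEN shifts `n ↦ n + 2j`;
* the dyadic decomposition of `[1, K]` into `⌊log₂ K⌋ + 1` blocks `[H₁, H₂]`, `H₂ < 2H₁`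
  (`exists_dyadic_block_ge`), replacing the printed remark (4.4);
* Lemma 1 of Robert–Sargos (= Graham–Kolesnik, *Van der Corput's Method of Exponential Sums*,
  Lemma 6.1), the `A × A` differencing of a double sum: for `a(m, h)` supported in
  `(0, M] × (0, H]`, `1 ≤ Q ≤ M`, `1 ≤ R ≤ H`,
  `‖∑ a(m,h)‖² ≤ (4MH/(QR)) ‖∑_{|q|<Q} ∑_{|r|<R} (1 - |q|/Q)(1 - |r|/R) ∑_{m,h} a(m+q,h) conj a(m,h+r)‖`
  (`aProcess_AA`), by the same Cauchy–Schwarz over the shifts `(m, h) ↦ (m + i, h + j)`,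
  `0 ≤ i < Q`, `0 ≤ j < R`, and the counting identity
  `∑_{i,i'<Q} F(i - i') = ∑_{|q|<Q} (Q - |q|) F(q)` (`sum_range_range_sub`).

## References

* O. Robert, P. Sargos, *A fourth derivative test for exponential sums*, Compositio Math. 130 (2002),
  275–292 (= arXiv:2307.03562), Lemma 1, (4.3)–(4.6).
* S. W. Graham, G. Kolesnik, *Van der Corput's Method of Exponential Sums*, LMS LN 126, CUP 1991,
  Lemma 6.1.
* M. N. Huxley, *Area, Lattice Points and Exponential Sums*, OUP 1996, Lemma 5.6.2.
-/

noncomputable section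

namespace Literature.NumberTheory.LFunctions
namespace RobertSargos

open Finset
open Literature.NumberTheory.LFunctions.VdC

/-! ### The symmetric Weyl–van der Corput inequality -/

section symmetric

variable {z : ℤ → ℂ} {a b : ℤ} (hz : ∀ n, n ∉ Finset.Ioc a b → z n = 0)
include hz

/-- Row `j`, lower part, even shifts: `∑_{j'<j} Re C(2(j - j')) = ∑_{i<j} Re C(2(i+1))`. [folklore] -/
theorem row_lower_eq₂ (j : ℕ) :
    ∑ j' ∈ Finset.range j, (corr z a b (2 * ((j : ℤ) - j'))).re
      = ∑ i ∈ Finset.range j, (corr z a b (2 * ((i : ℤ) + 1))).re := by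
  have _ := hz
  rw [← Finset.sum_range_reflect (fun i => (corr z a b (2 * ((i : ℤ) + 1))).re) j]
  refine Finset.sum_congr rfl fun j' hj' => ?_
  rw [Finset.mem_range] at hj'
  have e : (((j - 1 - j' : ℕ) : ℤ)) + 1 = (j : ℤ) - j' := by
    have h2 : ((j - 1 - j' : ℕ) : ℤ) = ((j : ℕ) : ℤ) - 1 - j' := by
      rw [Nat.sub_sub, Nat.cast_sub (by omega)]
      push_cast; ring
    rw [h2]; ring
  simp only [e]

/-- Row `j`, upper part, even shifts (`j < H`). [folklore] -/
theorem row_upper_eq₂ {H j : ℕ} (hj : j < H) :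
    ∑ j' ∈ Finset.Ico (j + 1) H, (corr z a b (2 * ((j : ℤ) - j'))).re
      = ∑ i ∈ Finset.range (H - 1 - j), (corr z a b (2 * ((i : ℤ) + 1))).re := by
  rw [Finset.sum_Ico_eq_sum_range, show H - (j + 1) = H - 1 - j by omega]
  refine Finset.sum_congr rfl fun i _ => ?_
  have e : 2 * ((j : ℤ) - ((j + 1 + i : ℕ) : ℤ)) = -(2 * (((i : ℤ) + 1))) := by push_cast; ring
  rw [e, corr_neg hz (by positivity), Complex.conj_re]

/-- Row `j` of the double sum of correlations with even shifts (`j < H`). [folklore] -/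
theorem row_sum_eq₂ {H j : ℕ} (hj : j < H) :
    ∑ j' ∈ Finset.range H, (corr z a b (2 * ((j : ℤ) - j'))).re
      = ∑ i ∈ Finset.range j, (corr z a b (2 * ((i : ℤ) + 1))).re + (corr z a b 0).re
        + ∑ i ∈ Finset.range (H - 1 - j), (corr z a b (2 * ((i : ℤ) + 1))).re := by
  rw [Finset.range_eq_Ico, ← Finset.sum_Ico_consecutive _ (Nat.zero_le j) hj.le,
    Finset.sum_eq_sum_Ico_succ_bot hj, sub_self, mul_zero, ← Finset.range_eq_Ico, row_lower_eq₂ hz,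
    row_upper_eq₂ hz hj]
  ring

/-- **Weighted Weyl–van der Corput inequality with symmetric (even) shifts.** For `z` supported
in `(a, b]` (`a ≤ b`) and `1 ≤ H`:
`H² ‖∑ z(n)‖² ≤ (b - a + 2H - 2)(H ‖C(0)‖ + 2 ∑_{i<H} (H - 1 - i) ‖C(2(i+1))‖)`, where
`C(d) = ∑ z(n+d) conj z(n)` (`VdC.corr`). [cite: RobertSargos2002, (4.3)] -/
theorem vanDerCorput_symmetric (hab : a ≤ b) {H : ℕ} (hH : 1 ≤ H) :
    (H : ℝ) ^ 2 * ‖∑ n ∈ Finset.Ioc a b, z n‖ ^ 2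
      ≤ ((b : ℝ) - a + 2 * H - 2) * (H * ‖corr z a b 0‖
          + 2 * ∑ i ∈ Finset.range H, ((H : ℝ) - 1 - i) * ‖corr z a b (2 * ((i : ℤ) + 1))‖) := by
  set S := ∑ n ∈ Finset.Ioc a b, z n with hS
  set M : Finset ℤ := Finset.Ioc (a - 2 * H + 2) b with hM
  have hcardM : (M.card : ℝ) = (b : ℝ) - a + 2 * H - 2 := by
    rw [hM, Int.card_Ioc]
    have h0 : 0 ≤ b - (a - 2 * H + 2) := by omega
    have h1 : (((b - (a - 2 * H + 2)).toNat : ℕ) : ℤ) = b - (a - 2 * H + 2) := Int.toNat_of_nonneg h0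
    have h2 : (((b - (a - 2 * H + 2)).toNat : ℕ) : ℝ) = ((b - (a - 2 * H + 2) : ℤ) : ℝ) := by
      exact_mod_cast h1
    rw [h2]; push_cast; ring
  -- Step 1: `H S = ∑_{m ∈ M} ∑_{j < H} z(m + 2j)`
  have hshift : ∀ j ∈ Finset.range H, ∑ m ∈ M, z (m + 2 * j) = S := by
    intro j hj
    rw [Finset.mem_range] at hj
    rw [hM, sum_Ioc_shift, hS]
    exact sum_eq_sum_of_vanish (Finset.Ioc_subset_Ioc (by omega) (by omega)) hz
  have hHS : (H : ℂ) * S = ∑ m ∈ M, ∑ j ∈ Finset.range H, z (m + 2 * j) := by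
    rw [Finset.sum_comm, Finset.sum_congr rfl hshift, Finset.sum_const, Finset.card_range,
      nsmul_eq_mul]
  -- Step 2: Cauchy–Schwarz
  have hCS := norm_sq_sum_le_card_mul M (fun m => ∑ j ∈ Finset.range H, z (m + 2 * j))
  -- Step 3: expand the squares
  have hexp : ∑ m ∈ M, ‖∑ j ∈ Finset.range H, z (m + 2 * j)‖ ^ 2
      = ∑ j ∈ Finset.range H, ∑ j' ∈ Finset.range H, (corr z a b (2 * ((j : ℤ) - j'))).re := by
    have h1 : ∀ m ∈ M, ‖∑ j ∈ Finset.range H, z (m + 2 * j)‖ ^ 2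
        = ∑ j ∈ Finset.range H, ∑ j' ∈ Finset.range H,
            (z (m + 2 * j) * (starRingEnd ℂ) (z (m + 2 * j'))).re :=
      fun m _ => norm_sq_sum_eq _ _
    rw [Finset.sum_congr rfl h1, Finset.sum_comm]
    refine Finset.sum_congr rfl fun j hj => ?_
    rw [Finset.sum_comm]
    refine Finset.sum_congr rfl fun j' hj' => ?_
    rw [← Complex.re_sum]
    congr 1
    rw [Finset.mem_range] at hj hj'
    have h2 := sum_Ioc_shift (fun n => z (n + 2 * ((j : ℤ) - j')) * (starRingEnd ℂ) (z n))
      (a - 2 * H + 2) b (2 * j')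
    have h3 : ∀ m : ℤ, z (m + 2 * j) * (starRingEnd ℂ) (z (m + 2 * j'))
        = z (m + 2 * j' + 2 * ((j : ℤ) - j')) * (starRingEnd ℂ) (z (m + 2 * j')) := by
      intro m
      have : m + 2 * j' + 2 * ((j : ℤ) - j') = m + 2 * j := by ring
      rw [this]
    rw [hM, Finset.sum_congr rfl (fun m _ => h3 m), h2]
    unfold corr
    apply sum_eq_sum_of_vanish (Finset.Ioc_subset_Ioc (by omega) (by omega))
    intro n hn
    simp only [hz n hn, map_zero, mul_zero]
  -- Step 4: the double sum with its triangular weights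
  have hcorr : ∑ j ∈ Finset.range H, ∑ j' ∈ Finset.range H, (corr z a b (2 * ((j : ℤ) - j'))).re
      ≤ H * ‖corr z a b 0‖
        + 2 * ∑ i ∈ Finset.range H, ((H : ℝ) - 1 - i) * ‖corr z a b (2 * ((i : ℤ) + 1))‖ := by
    have hrows : ∀ j ∈ Finset.range H, ∑ j' ∈ Finset.range H, (corr z a b (2 * ((j : ℤ) - j'))).re
        ≤ ∑ i ∈ Finset.range j, ‖corr z a b (2 * ((i : ℤ) + 1))‖ + ‖corr z a b 0‖
          + ∑ i ∈ Finset.range (H - 1 - j), ‖corr z a b (2 * ((i : ℤ) + 1))‖ := by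
      intro j hj
      rw [Finset.mem_range] at hj
      rw [row_sum_eq₂ hz hj]
      gcongr with i _ i _
      · exact Complex.re_le_norm _
      · exact Complex.re_le_norm _
      · exact Complex.re_le_norm _
    refine (Finset.sum_le_sum hrows).trans (le_of_eq ?_)
    rw [Finset.sum_add_distrib, Finset.sum_add_distrib, Finset.sum_const, Finset.card_range,
      nsmul_eq_mul, sum_range_sum_range_eq (fun i => ‖corr z a b (2 * ((i : ℤ) + 1))‖) H,
      sum_range_sum_range_reflect_eq (fun i => ‖corr z a b (2 * ((i : ℤ) + 1))‖) H]
    ring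
  -- assemble
  have hnormHS : (H : ℝ) ^ 2 * ‖S‖ ^ 2 = ‖(H : ℂ) * S‖ ^ 2 := by
    rw [norm_mul, Complex.norm_natCast]; ring
  rw [hnormHS, hHS]
  have hM0 : (0 : ℝ) ≤ (b : ℝ) - a + 2 * H - 2 := by rw [← hcardM]; positivity
  calc ‖∑ m ∈ M, ∑ j ∈ Finset.range H, z (m + 2 * j)‖ ^ 2
      ≤ M.card * ∑ m ∈ M, ‖∑ j ∈ Finset.range H, z (m + 2 * j)‖ ^ 2 := hCS
    _ = ((b : ℝ) - a + 2 * H - 2) * ∑ j ∈ Finset.range H, ∑ j' ∈ Finset.range H,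
          (corr z a b (2 * ((j : ℤ) - j'))).re := by rw [hcardM, hexp]
    _ ≤ _ := mul_le_mul_of_nonneg_left hcorr hM0

/-- The even-shift correlation as a symmetric difference: for `d ≥ 0`,
`C(2d) = ∑_{a+d<n≤b-d} z(n+d) conj z(n-d)`. [folklore] -/
theorem corr_two_mul_eq {d : ℤ} (hd : 0 ≤ d) :
    corr z a b (2 * d) = ∑ n ∈ Finset.Ioc (a + d) (b - d), z (n + d) * (starRingEnd ℂ) (z (n - d)) := by
  rw [corr_eq_sum_Ioc_sub hz (by linarith)]
  have h2 := sum_Ioc_shift (fun n => z (n + d) * (starRingEnd ℂ) (z (n - d))) a (b - 2 * d) d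
  rw [show b - 2 * d + d = b - d by ring] at h2
  rw [← h2]
  refine Finset.sum_congr rfl fun m _ => ?_
  simp only [add_sub_cancel_right]
  congr 2; ring

end symmetric

/-- **Symmetric Weyl differencing for exponential sums** (Robert–Sargos (4.3), Huxley Lemma 5.6.2):
for a real phase `f`, integers `a ≤ b` with `L = b - a` and `1 ≤ H ≤ L`,
`‖∑_{a<n≤b} e(f(n))‖² ≤ 3L²/H + (6L/H) ∑_{d=1}^{H-1} ‖∑_{a+d<n≤b-d} e(f(n+d) - f(n-d))‖`.
[cite: RobertSargos2002, (4.3)] -/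
theorem vanDerCorput_symmetric_e (f : ℝ → ℝ) {a b : ℤ} {H : ℕ} (hH : 1 ≤ H)
    (hHL : (H : ℤ) ≤ b - a) :
    ‖∑ n ∈ Finset.Ioc a b, e (f n)‖ ^ 2
      ≤ 3 * ((b : ℝ) - a) ^ 2 / H
        + 6 * ((b : ℝ) - a) / H *
          ∑ d ∈ Finset.Ico 1 H,
            ‖∑ n ∈ Finset.Ioc (a + d) (b - d), e (f ((n + d : ℤ)) - f ((n - d : ℤ)))‖ := by
  classical
  have hab : a ≤ b := by omega
  set z : ℤ → ℂ := fun n => if n ∈ Finset.Ioc a b then e (f n) else 0 with hzdef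
  have hz : ∀ n, n ∉ Finset.Ioc a b → z n = 0 := fun n hn => by
    simp only [hzdef]; rw [if_neg hn]
  have hS : ∑ n ∈ Finset.Ioc a b, e (f n) = ∑ n ∈ Finset.Ioc a b, z n :=
    Finset.sum_congr rfl fun n hn => by simp only [hzdef]; rw [if_pos hn]
  have hC0 : ‖corr z a b 0‖ = (b : ℝ) - a := by
    unfold corr
    have h1 : ∀ n ∈ Finset.Ioc a b, z (n + 0) * (starRingEnd ℂ) (z n) = 1 := by
      intro n hn
      simp only [hzdef, add_zero]
      rw [if_pos hn, Complex.mul_conj, Complex.normSq_eq_norm_sq, norm_e]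
      norm_num
    rw [Finset.sum_congr rfl h1, Finset.sum_const, nsmul_eq_mul, mul_one, Int.card_Ioc]
    have h2 : (((b - a).toNat : ℕ) : ℤ) = b - a := Int.toNat_of_nonneg (by omega)
    rw [Complex.norm_natCast]
    have h4 : (((b - a).toNat : ℕ) : ℝ) = ((b - a : ℤ) : ℝ) := by exact_mod_cast h2
    rw [h4]; push_cast; ring
  have hcorr : ∀ d : ℕ, 1 ≤ d → d < H → ‖corr z a b (2 * (d : ℤ))‖ =
      ‖∑ n ∈ Finset.Ioc (a + d) (b - d), e (f ((n + d : ℤ)) - f ((n - d : ℤ)))‖ := by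
    intro d hd1 hdH
    rw [corr_two_mul_eq hz (by positivity)]
    congr 1
    refine Finset.sum_congr rfl fun n hn => ?_
    rw [Finset.mem_Ioc] at hn
    have h1 : n + d ∈ Finset.Ioc a b := by rw [Finset.mem_Ioc]; omega
    have h2 : n - d ∈ Finset.Ioc a b := by rw [Finset.mem_Ioc]; omega
    simp only [hzdef]
    rw [if_pos h1, if_pos h2, e_sub]
  have hmain := vanDerCorput_symmetric hz hab hH
  rw [← hS, hC0] at hmain
  set L : ℝ := (b : ℝ) - a with hL
  set T : ℝ := ∑ d ∈ Finset.Ico 1 H,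
      ‖∑ n ∈ Finset.Ioc (a + d) (b - d), e (f ((n + d : ℤ)) - f ((n - d : ℤ)))‖ with hT
  have hT0 : 0 ≤ T := Finset.sum_nonneg fun d _ => norm_nonneg _
  -- `∑_{i<H} (H-1-i) ‖C(2(i+1))‖ ≤ H T` (the term `i = H-1` has weight `0`)
  set X : ℝ := ∑ i ∈ Finset.range H, ((H : ℝ) - 1 - i) * ‖corr z a b (2 * ((i : ℤ) + 1))‖ with hX
  have hXT : X ≤ H * T := by
    obtain ⟨H', rfl⟩ : ∃ H', H = H' + 1 := ⟨H - 1, by omega⟩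
    rw [hX, Finset.sum_range_succ]
    have hw0 : (((H' + 1 : ℕ) : ℝ) - 1 - (H' : ℕ)) * ‖corr z a b (2 * ((H' : ℤ) + 1))‖ = 0 := by
      push_cast; ring
    rw [hw0, add_zero]
    have h1 : ∑ i ∈ Finset.range H', (((H' + 1 : ℕ) : ℝ) - 1 - i) * ‖corr z a b (2 * ((i : ℤ) + 1))‖ ≤
        ∑ i ∈ Finset.range H', ((H' + 1 : ℕ) : ℝ) * ‖corr z a b (2 * ((i : ℤ) + 1))‖ := by
      refine Finset.sum_le_sum fun i _ => ?_
      apply mul_le_mul_of_nonneg_right _ (norm_nonneg _)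
      have : (0 : ℝ) ≤ i := Nat.cast_nonneg i
      linarith
    refine h1.trans ?_
    rw [← Finset.mul_sum]
    apply mul_le_mul_of_nonneg_left _ (Nat.cast_nonneg _)
    rw [hT, Finset.sum_Ico_eq_sum_range, show H' + 1 - 1 = H' by omega]
    refine Finset.sum_le_sum fun i hi => le_of_eq ?_
    rw [Finset.mem_range] at hi
    rw [← hcorr (1 + i) (by omega) (by omega)]
    congr 2; push_cast; ring
  have hHpos : (0 : ℝ) < H := by exact_mod_cast hH
  have hH1 : (1 : ℝ) ≤ H := by exact_mod_cast hH
  have hHL' : (H : ℝ) ≤ L := by rw [hL]; exact_mod_cast hHL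
  have hL0 : 0 ≤ L := by linarith
  -- `H² S² ≤ (L + 2H - 2)(HL + 2X) ≤ 3L · (HL + 2HT)`
  have hA : L + 2 * H - 2 ≤ 3 * L := by linarith
  have hA0 : 0 ≤ L + 2 * H - 2 := by linarith
  have hB : (H : ℝ) * L + 2 * X ≤ H * L + 2 * (H * T) := by linarith
  have hB0 : 0 ≤ (H : ℝ) * L + 2 * X := by
    have : 0 ≤ X := Finset.sum_nonneg fun i hi => by
      rw [Finset.mem_range] at hi
      apply mul_nonneg _ (norm_nonneg _)
      have : (i : ℝ) + 1 ≤ H := by exact_mod_cast hi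
      linarith
    positivity
  have h1 : (H : ℝ) ^ 2 * ‖∑ n ∈ Finset.Ioc a b, e (f n)‖ ^ 2 ≤ (3 * L) * (H * L + 2 * (H * T)) :=
    hmain.trans ((mul_le_mul hA hB hB0 (by positivity)))
  have h2 : ‖∑ n ∈ Finset.Ioc a b, e (f n)‖ ^ 2 ≤ (3 * L) * (L + 2 * T) / H := by
    rw [le_div_iff₀ hHpos]
    have : (H : ℝ) * ‖∑ n ∈ Finset.Ioc a b, e (f n)‖ ^ 2 * H ≤ (3 * L) * (L + 2 * T) * H := by
      nlinarith
    nlinarith [norm_nonneg (∑ n ∈ Finset.Ioc a b, e (f n))]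
  calc ‖∑ n ∈ Finset.Ioc a b, e (f n)‖ ^ 2 ≤ (3 * L) * (L + 2 * T) / H := h2
    _ = 3 * L ^ 2 / H + 6 * L / H * T := by field_simp; ring

/-! ### Dyadic blocks -/

/-- Telescoping the dyadic blocks `(K/2^{i+1}, K/2^i]`. [folklore] -/
theorem sum_dyadic_blocks (g : ℕ → ℝ) (K n : ℕ) :
    ∑ i ∈ Finset.range n, ∑ d ∈ Finset.Ioc (K / 2 ^ (i + 1)) (K / 2 ^ i), g d
      = ∑ d ∈ Finset.Ioc (K / 2 ^ n) K, g d := by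
  induction n with
  | zero => simp
  | succ n ih =>
    rw [Finset.sum_range_succ, ih]
    have h1 : K / 2 ^ (n + 1) ≤ K / 2 ^ n :=
      Nat.div_le_div_left (Nat.pow_le_pow_right (by norm_num) (Nat.le_succ n)) (by positivity)
    have h2 : K / 2 ^ n ≤ K := Nat.div_le_self _ _
    rw [add_comm, Finset.sum_Ioc_consecutive _ h1 h2]

/-- **Dyadic pigeonhole** (replacing Robert–Sargos (4.4)): for `g ≥ 0` and `K ≥ 1` there is a block
`[H₁, H₂] ⊆ [1, K]` with `H₂ < 2H₁` and `∑_{d=1}^{K} g(d) ≤ (⌊log₂ K⌋ + 1) ∑_{d=H₁}^{H₂} g(d)`.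
[cite: RobertSargos2002, (4.4)] -/
theorem exists_dyadic_block {g : ℕ → ℝ} {K : ℕ} (hK : 1 ≤ K) :
    ∃ H₁ H₂ : ℕ, 1 ≤ H₁ ∧ H₁ ≤ H₂ ∧ H₂ ≤ K ∧ H₂ < 2 * H₁ ∧
      ∑ d ∈ Finset.Icc 1 K, g d ≤ ((Nat.log 2 K : ℝ) + 1) * ∑ d ∈ Finset.Icc H₁ H₂, g d := by
  classical
  set I : ℕ := Nat.log 2 K with hI
  set blk : ℕ → ℝ := fun i => ∑ d ∈ Finset.Ioc (K / 2 ^ (i + 1)) (K / 2 ^ i), g d with hblk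
  have htot : ∑ d ∈ Finset.Icc 1 K, g d = ∑ i ∈ Finset.range (I + 1), blk i := by
    rw [hblk, sum_dyadic_blocks g K (I + 1)]
    have h0 : K / 2 ^ (I + 1) = 0 := Nat.div_eq_of_lt (Nat.lt_pow_succ_log_self (by norm_num) K)
    rw [h0]
    rfl
  obtain ⟨i₀, hi₀, hmax⟩ := Finset.exists_max_image (Finset.range (I + 1)) blk
    ⟨0, by simp⟩
  rw [Finset.mem_range] at hi₀
  set c : ℕ := K / 2 ^ (i₀ + 1) with hc
  set d' : ℕ := K / 2 ^ i₀ with hd'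
  have hd'1 : 1 ≤ d' := by
    rw [hd']
    apply (Nat.le_div_iff_mul_le (by positivity)).2
    rw [one_mul]
    calc 2 ^ i₀ ≤ 2 ^ I := Nat.pow_le_pow_right (by norm_num) (by omega)
      _ ≤ K := Nat.pow_log_le_self 2 (by omega)
  have hcd : c = d' / 2 := by rw [hc, hd', pow_succ, Nat.div_div_eq_div_mul]
  refine ⟨c + 1, d', by omega, by omega, Nat.div_le_self _ _, by omega, ?_⟩
  rw [htot]
  have h1 : ∑ i ∈ Finset.range (I + 1), blk i ≤ ∑ i ∈ Finset.range (I + 1), blk i₀ :=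
    Finset.sum_le_sum fun i hi => hmax i hi
  refine h1.trans ?_
  rw [Finset.sum_const, Finset.card_range, nsmul_eq_mul]
  push_cast
  apply le_of_eq
  congr 1
  rw [hblk]
  simp only
  rw [← hc, ← hd', ← Finset.Icc_add_one_left_eq_Ioc]

/-! ### The counting identity `∑_{i,i'<Q} F(i - i') = ∑_{|q|<Q} (Q - |q|) F(q)` -/

/-- The fibre `{(i, i') ∈ [0,Q)² : i - i' = q}` has `Q - |q|` elements (`|q| < Q`). [folklore] -/
theorem card_fiber_sub (Q : ℕ) (q : ℤ) (hq : |q| < Q) :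
    ((Finset.range Q ×ˢ Finset.range Q).filter (fun p : ℕ × ℕ => (p.1 : ℤ) - p.2 = q)).card
      = Q - q.natAbs := by
  rw [← Finset.card_range (Q - q.natAbs)]
  refine Finset.card_nbij' (fun p => p.1 - q.toNat) (fun k => (k + q.toNat, k + (-q).toNat))
    ?_ ?_ ?_ ?_
  · intro p hp
    rw [Finset.mem_coe, Finset.mem_filter, Finset.mem_product, Finset.mem_range, Finset.mem_range] at hp
    rw [Finset.mem_coe, Finset.mem_range]
    rw [abs_lt] at hq
    simp only
    omega
  · intro k hk
    rw [Finset.mem_coe, Finset.mem_range] at hk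
    rw [Finset.mem_coe, Finset.mem_filter, Finset.mem_product, Finset.mem_range, Finset.mem_range]
    simp only
    rw [abs_lt] at hq
    omega
  · intro p hp
    rw [Finset.mem_coe, Finset.mem_filter, Finset.mem_product, Finset.mem_range, Finset.mem_range] at hp
    rw [abs_lt] at hq
    ext <;> simp only <;> omega
  · intro k hk
    rw [Finset.mem_coe, Finset.mem_range] at hk
    simp only
    omega

/-- `∑_{i<Q} ∑_{i'<Q} F(i - i') = ∑_{|q|<Q} (Q - |q|) F(q)`. [folklore] -/
theorem sum_range_range_sub (Q : ℕ) (F : ℤ → ℂ) :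
    ∑ i ∈ Finset.range Q, ∑ i' ∈ Finset.range Q, F ((i : ℤ) - i')
      = ∑ q ∈ Finset.Ioo (-(Q : ℤ)) Q, ((Q - q.natAbs : ℕ) : ℂ) * F q := by
  classical
  rw [← Finset.sum_product (s := Finset.range Q) (t := Finset.range Q) (f := fun p => F ((p.1 : ℤ) - p.2))]
  have hmaps : ∀ p ∈ Finset.range Q ×ˢ Finset.range Q,
      (fun p : ℕ × ℕ => (p.1 : ℤ) - p.2) p ∈ Finset.Ioo (-(Q : ℤ)) Q := by
    intro p hp
    rw [Finset.mem_product, Finset.mem_range, Finset.mem_range] at hp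
    rw [Finset.mem_Ioo]
    simp only
    constructor <;> omega
  rw [← Finset.sum_fiberwise_of_maps_to hmaps]
  refine Finset.sum_congr rfl fun q hq => ?_
  rw [Finset.mem_Ioo] at hq
  have hsum : ∑ p ∈ (Finset.range Q ×ˢ Finset.range Q).filter (fun p : ℕ × ℕ => (p.1 : ℤ) - p.2 = q),
      F ((p.1 : ℤ) - p.2) =
      ∑ p ∈ (Finset.range Q ×ˢ Finset.range Q).filter (fun p : ℕ × ℕ => (p.1 : ℤ) - p.2 = q), F q := by
    refine Finset.sum_congr rfl fun p hp => ?_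
    rw [Finset.mem_filter] at hp
    rw [hp.2]
  rw [hsum, Finset.sum_const, nsmul_eq_mul, card_fiber_sub Q q (by rw [abs_lt]; constructor <;> omega)]

/-! ### Tools for double sums -/

/-- `‖∑ v‖² = Re ∑∑ v conj v`. [folklore] -/
theorem norm_sq_sum_eq_re {α : Type*} (T : Finset α) (v : α → ℂ) :
    ‖∑ x ∈ T, v x‖ ^ 2 = (∑ x ∈ T, ∑ x' ∈ T, v x * (starRingEnd ℂ) (v x')).re := by
  have h1 : ‖∑ x ∈ T, v x‖ ^ 2 = ((∑ x ∈ T, v x) * (starRingEnd ℂ) (∑ x ∈ T, v x)).re := by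
    rw [Complex.mul_conj, Complex.ofReal_re, Complex.normSq_eq_norm_sq]
  rw [h1, map_sum, Finset.sum_mul_sum]

/-- Cauchy–Schwarz `‖∑_{x ∈ T} w x‖² ≤ #T ∑ ‖w x‖²`. [folklore] -/
theorem norm_sq_sum_le_card_mul' {α : Type*} (T : Finset α) (w : α → ℂ) :
    ‖∑ x ∈ T, w x‖ ^ 2 ≤ T.card * ∑ x ∈ T, ‖w x‖ ^ 2 := by
  calc ‖∑ x ∈ T, w x‖ ^ 2 ≤ (∑ x ∈ T, ‖w x‖) ^ 2 := by
        gcongr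
        exact norm_sum_le _ _
    _ ≤ T.card * ∑ x ∈ T, ‖w x‖ ^ 2 := sq_sum_le_card_mul_sum_sq

/-- Shifting both variables of a double sum over integer intervals. [folklore] -/
theorem sum_Ioc_Ioc_shift (F : ℤ → ℤ → ℂ) (c₁ d₁ c₂ d₂ s t : ℤ) :
    ∑ m ∈ Finset.Ioc c₁ d₁, ∑ h ∈ Finset.Ioc c₂ d₂, F (m + s) (h + t)
      = ∑ m ∈ Finset.Ioc (c₁ + s) (d₁ + s), ∑ h ∈ Finset.Ioc (c₂ + t) (d₂ + t), F m h := by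
  rw [sum_Ioc_shift (fun m => ∑ h ∈ Finset.Ioc c₂ d₂, F m (h + t)) c₁ d₁ s]
  exact Finset.sum_congr rfl fun m _ => sum_Ioc_shift (fun h => F m h) c₂ d₂ t

/-- Restricting a double sum to the support. [folklore] -/
theorem sum_sum_eq_of_vanish {F : ℤ → ℤ → ℂ} {A A' B B' : Finset ℤ} (hA : A' ⊆ A) (hB : B' ⊆ B)
    (hF : ∀ m h, F m h ≠ 0 → m ∈ A' ∧ h ∈ B') :
    ∑ m ∈ A, ∑ h ∈ B, F m h = ∑ m ∈ A', ∑ h ∈ B', F m h := by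
  have hin : ∀ m, ∑ h ∈ B, F m h = ∑ h ∈ B', F m h := by
    intro m
    symm
    apply Finset.sum_subset hB
    intro h _ hh
    by_contra hne
    exact hh (hF m h hne).2
  rw [Finset.sum_congr rfl fun m _ => hin m]
  symm
  apply Finset.sum_subset hA
  intro m _ hm
  apply Finset.sum_eq_zero
  intro h _
  by_contra hne
  exact hm (hF m h hne).1

/-! ### The `A × A` lemma (Robert–Sargos Lemma 1, Graham–Kolesnik Lemma 6.1) -/

/-- **The `A × A` differencing lemma** (Robert–Sargos, Lemma 1 = Graham–Kolesnik, Lemma 6.1).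
Let `a(m, h)` be complex numbers vanishing unless `(m, h) ∈ (0, M] × (0, H]`, and let
`1 ≤ Q ≤ M`, `1 ≤ R ≤ H`. Then
`‖∑_{m,h} a(m,h)‖² ≤ (4MH/(QR)) ‖∑_{|q|<Q} ∑_{|r|<R} (1 - |q|/Q)(1 - |r|/R) ∑_{m,h} a(m+q,h) conj a(m,h+r)‖`.
[cite: RobertSargos2002, Lemma 1] -/
theorem aProcess_AA (a : ℤ → ℤ → ℂ) (M H : ℕ)
    (ha : ∀ m h, a m h ≠ 0 → m ∈ Finset.Ioc (0 : ℤ) M ∧ h ∈ Finset.Ioc (0 : ℤ) H)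
    {Q R : ℕ} (hQ : 1 ≤ Q) (hQM : Q ≤ M) (hR : 1 ≤ R) (hRH : R ≤ H) :
    ‖∑ m ∈ Finset.Ioc (0 : ℤ) M, ∑ h ∈ Finset.Ioc (0 : ℤ) H, a m h‖ ^ 2 ≤
      4 * (M : ℝ) * H / (Q * R) *
        ‖∑ q ∈ Finset.Ioo (-(Q : ℤ)) Q, ∑ r ∈ Finset.Ioo (-(R : ℤ)) R,
          (((1 - |(q : ℝ)| / Q) * (1 - |(r : ℝ)| / R) : ℝ) : ℂ) *
            ∑ m ∈ Finset.Ioc (0 : ℤ) M, ∑ h ∈ Finset.Ioc (0 : ℤ) H,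
              a (m + q) h * (starRingEnd ℂ) (a m (h + r))‖ := by
  classical
  -- notation
  set S := ∑ m ∈ Finset.Ioc (0 : ℤ) M, ∑ h ∈ Finset.Ioc (0 : ℤ) H, a m h with hS
  set C : ℤ → ℤ → ℂ := fun q r => ∑ m ∈ Finset.Ioc (0 : ℤ) M, ∑ h ∈ Finset.Ioc (0 : ℤ) H,
    a (m + q) h * (starRingEnd ℂ) (a m (h + r)) with hC
  set Bm := Finset.Ioc (-(Q : ℤ)) M with hBm
  set Bh := Finset.Ioc (-(R : ℤ)) H with hBh
  set Box := Bm ×ˢ Bh with hBox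
  set IJ := Finset.range Q ×ˢ Finset.range R with hIJ
  have hQpos : (0 : ℝ) < Q := by exact_mod_cast hQ
  have hRpos : (0 : ℝ) < R := by exact_mod_cast hR
  -- Step 1: every shift reproduces `S`
  have hshift : ∀ ij ∈ IJ, ∑ p ∈ Box, a (p.1 + ij.1) (p.2 + ij.2) = S := by
    intro ij hij
    rw [hIJ, Finset.mem_product, Finset.mem_range, Finset.mem_range] at hij
    rw [hBox, Finset.sum_product, hBm, hBh,
      sum_Ioc_Ioc_shift (fun m h => a m h) _ _ _ _ (ij.1 : ℤ) (ij.2 : ℤ), hS]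
    apply sum_sum_eq_of_vanish (Finset.Ioc_subset_Ioc (by omega) (by omega))
      (Finset.Ioc_subset_Ioc (by omega) (by omega)) ha
  have hQRS : ((Q * R : ℕ) : ℂ) * S = ∑ p ∈ Box, ∑ ij ∈ IJ, a (p.1 + ij.1) (p.2 + ij.2) := by
    rw [Finset.sum_comm, Finset.sum_congr rfl hshift, Finset.sum_const, hIJ, Finset.card_product,
      Finset.card_range, Finset.card_range, nsmul_eq_mul]
  -- Step 2: Cauchy–Schwarz over the box
  have hcardBox : (Box.card : ℝ) = ((M : ℝ) + Q) * (H + R) := by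
    rw [hBox, Finset.card_product, hBm, hBh, Int.card_Ioc, Int.card_Ioc]
    push_cast
    have e1 : (((M : ℤ) - -(Q : ℤ)).toNat : ℝ) = (M : ℝ) + Q := by
      have : ((M : ℤ) - -(Q : ℤ)).toNat = M + Q := by omega
      rw [this]; push_cast; ring
    have e2 : (((H : ℤ) - -(R : ℤ)).toNat : ℝ) = (H : ℝ) + R := by
      have : ((H : ℤ) - -(R : ℤ)).toNat = H + R := by omega
      rw [this]; push_cast; ring
    rw [e1, e2]
  have hCS := norm_sq_sum_le_card_mul' Box (fun p => ∑ ij ∈ IJ, a (p.1 + ij.1) (p.2 + ij.2))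
  -- Step 3: expand the squares and identify the correlations
  have hexp : ∑ p ∈ Box, ‖∑ ij ∈ IJ, a (p.1 + ij.1) (p.2 + ij.2)‖ ^ 2 =
      (∑ ij ∈ IJ, ∑ ij' ∈ IJ, C ((ij.1 : ℤ) - ij'.1) ((ij'.2 : ℤ) - ij.2)).re := by
    have h1 : ∀ p ∈ Box, ‖∑ ij ∈ IJ, a (p.1 + ij.1) (p.2 + ij.2)‖ ^ 2 =
        (∑ ij ∈ IJ, ∑ ij' ∈ IJ, a (p.1 + ij.1) (p.2 + ij.2) *
          (starRingEnd ℂ) (a (p.1 + ij'.1) (p.2 + ij'.2))).re :=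
      fun p _ => norm_sq_sum_eq_re _ _
    rw [Finset.sum_congr rfl h1, ← Complex.re_sum, Finset.sum_comm]
    congr 1
    refine Finset.sum_congr rfl fun ij hij => ?_
    rw [Finset.sum_comm]
    refine Finset.sum_congr rfl fun ij' hij' => ?_
    rw [hIJ, Finset.mem_product, Finset.mem_range, Finset.mem_range] at hij hij'
    -- `∑_{p ∈ Box} a(p + ij) conj a(p + ij') = C(i - i', j' - j)`
    rw [hBox, Finset.sum_product, hBm, hBh]
    have h3 : ∀ m h : ℤ, a (m + ij.1) (h + ij.2) * (starRingEnd ℂ) (a (m + ij'.1) (h + ij'.2)) =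
        (fun m' h' => a (m' + ((ij.1 : ℤ) - ij'.1)) h' *
          (starRingEnd ℂ) (a m' (h' + ((ij'.2 : ℤ) - ij.2)))) (m + ij'.1) (h + ij.2) := by
      intro m h
      simp only
      congr 2
      · ring
      · congr 1; ring
    simp_rw [h3]
    rw [sum_Ioc_Ioc_shift (fun m' h' => a (m' + ((ij.1 : ℤ) - ij'.1)) h' *
        (starRingEnd ℂ) (a m' (h' + ((ij'.2 : ℤ) - ij.2)))) _ _ _ _ (ij'.1 : ℤ) (ij.2 : ℤ)]
    rw [hC]
    apply sum_sum_eq_of_vanish (Finset.Ioc_subset_Ioc (by omega) (by omega))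
      (Finset.Ioc_subset_Ioc (by omega) (by omega))
    intro m h hne
    have h4 : a m (h + ((ij'.2 : ℤ) - ij.2)) ≠ 0 := by
      intro h0; apply hne; rw [h0, map_zero, mul_zero]
    have h5 : a (m + ((ij.1 : ℤ) - ij'.1)) h ≠ 0 := by
      intro h0; apply hne; rw [h0, zero_mul]
    exact ⟨(ha _ _ h4).1, (ha _ _ h5).2⟩
  -- Step 4: the counting identity in both pairs of shift variables
  have hcount : ∑ ij ∈ IJ, ∑ ij' ∈ IJ, C ((ij.1 : ℤ) - ij'.1) ((ij'.2 : ℤ) - ij.2) =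
      ∑ q ∈ Finset.Ioo (-(Q : ℤ)) Q, ∑ r ∈ Finset.Ioo (-(R : ℤ)) R,
        ((Q - q.natAbs : ℕ) : ℂ) * (((R - r.natAbs : ℕ) : ℂ) * C q r) := by
    rw [hIJ, Finset.sum_product, Finset.sum_comm]
    -- `∑_j ∑_i ∑_{(i',j')} = ∑_j ∑_{j'} (∑_i ∑_{i'} C(i - i', j' - j))`
    have e1 : ∑ j ∈ Finset.range R, ∑ i ∈ Finset.range Q, ∑ ij' ∈ Finset.range Q ×ˢ Finset.range R,
        C ((i : ℤ) - ij'.1) ((ij'.2 : ℤ) - j) =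
        ∑ j ∈ Finset.range R, ∑ j' ∈ Finset.range R,
          ∑ q ∈ Finset.Ioo (-(Q : ℤ)) Q, ((Q - q.natAbs : ℕ) : ℂ) * C q ((j' : ℤ) - j) := by
      refine Finset.sum_congr rfl fun j _ => ?_
      have e2 : ∀ i ∈ Finset.range Q, ∑ ij' ∈ Finset.range Q ×ˢ Finset.range R, C ((i : ℤ) - ij'.1) ((ij'.2 : ℤ) - j)
          = ∑ j' ∈ Finset.range R, ∑ i' ∈ Finset.range Q, C ((i : ℤ) - i') ((j' : ℤ) - j) := by
        intro i _
        rw [Finset.sum_product, Finset.sum_comm]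
      rw [Finset.sum_congr rfl e2, Finset.sum_comm]
      refine Finset.sum_congr rfl fun j' _ => ?_
      exact sum_range_range_sub Q (fun q => C q ((j' : ℤ) - j))
    rw [e1]
    -- now the pair `(j, j')` with `F(j' - j)`
    rw [Finset.sum_comm]
    have e3 : ∑ j' ∈ Finset.range R, ∑ j ∈ Finset.range R,
        ∑ q ∈ Finset.Ioo (-(Q : ℤ)) Q, ((Q - q.natAbs : ℕ) : ℂ) * C q ((j' : ℤ) - j) =
        ∑ r ∈ Finset.Ioo (-(R : ℤ)) R, ((R - r.natAbs : ℕ) : ℂ) *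
          ∑ q ∈ Finset.Ioo (-(Q : ℤ)) Q, ((Q - q.natAbs : ℕ) : ℂ) * C q r :=
      sum_range_range_sub R (fun r => ∑ q ∈ Finset.Ioo (-(Q : ℤ)) Q, ((Q - q.natAbs : ℕ) : ℂ) * C q r)
    rw [e3, Finset.sum_comm]
    refine Finset.sum_congr rfl fun q _ => ?_
    rw [Finset.mul_sum]
    refine Finset.sum_congr rfl fun r _ => ?_
    ring
  -- Step 5: compare with the normalized weights
  have hweights : ∑ q ∈ Finset.Ioo (-(Q : ℤ)) Q, ∑ r ∈ Finset.Ioo (-(R : ℤ)) R,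
        ((Q - q.natAbs : ℕ) : ℂ) * (((R - r.natAbs : ℕ) : ℂ) * C q r) =
      ((Q * R : ℕ) : ℂ) * ∑ q ∈ Finset.Ioo (-(Q : ℤ)) Q, ∑ r ∈ Finset.Ioo (-(R : ℤ)) R,
          (((1 - |(q : ℝ)| / Q) * (1 - |(r : ℝ)| / R) : ℝ) : ℂ) * C q r := by
    rw [Finset.mul_sum]
    refine Finset.sum_congr rfl fun q hq => ?_
    rw [Finset.mul_sum]
    refine Finset.sum_congr rfl fun r hr => ?_
    rw [Finset.mem_Ioo] at hq hr
    have hq' : q.natAbs ≤ Q := by omega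
    have hr' : r.natAbs ≤ R := by omega
    have e1r : ((Q - q.natAbs : ℕ) : ℝ) = (Q : ℝ) - |(q : ℝ)| := by
      rw [Nat.cast_sub hq', Nat.cast_natAbs, Int.cast_abs]
    have e2r : ((R - r.natAbs : ℕ) : ℝ) = (R : ℝ) - |(r : ℝ)| := by
      rw [Nat.cast_sub hr', Nat.cast_natAbs, Int.cast_abs]
    have e1 : ((Q - q.natAbs : ℕ) : ℂ) = (((Q : ℝ) - |(q : ℝ)| : ℝ) : ℂ) := by
      rw [← e1r]; norm_cast
    have e2 : ((R - r.natAbs : ℕ) : ℂ) = (((R : ℝ) - |(r : ℝ)| : ℝ) : ℂ) := by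
      rw [← e2r]; norm_cast
    rw [e1, e2]
    have hQ0 : (Q : ℂ) ≠ 0 := by exact_mod_cast (by omega : Q ≠ 0)
    have hR0 : (R : ℂ) ≠ 0 := by exact_mod_cast (by omega : R ≠ 0)
    push_cast
    field_simp
  -- Step 6: assemble
  set W := ∑ q ∈ Finset.Ioo (-(Q : ℤ)) Q, ∑ r ∈ Finset.Ioo (-(R : ℤ)) R,
      (((1 - |(q : ℝ)| / Q) * (1 - |(r : ℝ)| / R) : ℝ) : ℂ) * C q r with hW
  have hkey : ((Q : ℝ) * R) ^ 2 * ‖S‖ ^ 2 ≤ ((M : ℝ) + Q) * (H + R) * ((Q : ℝ) * R * ‖W‖) := by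
    have h1 : ((Q : ℝ) * R) ^ 2 * ‖S‖ ^ 2 = ‖((Q * R : ℕ) : ℂ) * S‖ ^ 2 := by
      rw [norm_mul, Complex.norm_natCast]; push_cast; ring
    rw [h1, hQRS]
    refine hCS.trans ?_
    rw [hcardBox, hexp, hcount, hweights]
    apply mul_le_mul_of_nonneg_left _ (by positivity)
    refine (Complex.re_le_norm _).trans (le_of_eq ?_)
    rw [norm_mul, Complex.norm_natCast]; push_cast; ring
  have hMQ : ((M : ℝ) + Q) * (H + R) ≤ 4 * (M : ℝ) * H := by
    have h1 : (Q : ℝ) ≤ M := by exact_mod_cast hQM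
    have h2 : (R : ℝ) ≤ H := by exact_mod_cast hRH
    nlinarith
  have hW0 := norm_nonneg W
  have hfin : ((Q : ℝ) * R) ^ 2 * ‖S‖ ^ 2 ≤ (4 * (M : ℝ) * H) * ((Q : ℝ) * R * ‖W‖) :=
    hkey.trans (mul_le_mul_of_nonneg_right hMQ (by positivity))
  rw [div_mul_eq_mul_div, le_div_iff₀ (by positivity)]
  have h3 : ((Q : ℝ) * R) * (‖S‖ ^ 2 * (Q * R)) ≤ ((Q : ℝ) * R) * (4 * (M : ℝ) * H * ‖W‖) := by
    calc ((Q : ℝ) * R) * (‖S‖ ^ 2 * (Q * R)) = ((Q : ℝ) * R) ^ 2 * ‖S‖ ^ 2 := by ring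
      _ ≤ (4 * (M : ℝ) * H) * ((Q : ℝ) * R * ‖W‖) := hfin
      _ = ((Q : ℝ) * R) * (4 * (M : ℝ) * H * ‖W‖) := by ring
  exact le_of_mul_le_mul_left h3 (by positivity)

end RobertSargos
end Literature.NumberTheory.LFunctions
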